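import Mathlib
import HarnessLib
import Summits.ResolutionOfSingularities.ResolutionOfSingularities.Theorems.WildQuotientsWildQuotientResolutionThirdConeChartCube

/-!
# Theorem T3, centre: the reduced vertex ideal of `⅓(1^a,2^b) × 𝔸^c` is prime
(crux stmt-ResolutionOfSingularities-15640 `WildQuotients.WildQuotientResolution`, line `Sketch`;
chain w45c NEXT RUNG R-T, conjecture T3 (res-L1-w45c-idea-2 RT-LADDER v1.2 §5), res-L1-w45c-plan-1 GO
2026-08-27T10:03:49Z; vocabulary `ThirdCone.*` (p522660), tools of `…ThirdConeChartCube` (p524492);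
[OURS · L1 W4.5c] — NOT a statement of any manuscript; replaces the role of no printed item.
Prover res-L1-w45c-stub-2.)

The `hJ₀`/radical input that a V4U-style cone brick (`BlowupExit.exists_isBlowup_regular_of_…`)
needs next to `ThirdCone.blowup_regular` (p527123):
* `ThirdCone.monomial_mem_vertexIdeal` — GENERATION: every weight-`0` monomial touching a
  non-passenger variable lies in `vertexIdeal` (it is divisible, with weight-`0` quotient, by a mixed
  pair `x_iy_j` or by a triple `x_ix_jx_l` / `y_iy_jy_l` — extracted from the support);
* `ThirdCone.passengerProj_monomial`, `ThirdCone.vertexIdeal_eq_ker` — `vertexIdeal` is the kernel of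
  the passenger projection `cone → k[x]` (`x_s ↦ x_s` for `w_s = 0`, `x_s ↦ 0` otherwise);
* `ThirdCone.vertexIdeal_isPrime`, `ThirdCone.vertexIdeal_isRadical`.
-/

-- single-problem summit: the doubled namespace component `ResolutionOfSingularities` is forced
set_option linter.dupNamespace false

noncomputable section

open MvPolynomial

namespace Summit.ResolutionOfSingularities.ResolutionOfSingularities.Theorems.WildQuotientResolution.ThirdCone

variable (k : Type) [Field k] (n : ℕ) (w : Fin n → ZMod 3)

/-! ## Factoring a vertex generator out of a weight-`0` monomial -/

/-- A triple of variables of the same non-zero weight indexes a vertex generator. [OURS · L1 W4.5c] -/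
theorem exists_vertexExp_triple {u : ZMod 3} (hu : u ≠ 0) (i j l : Fin n) (hi : w i = u)
    (hj : w j = u) (hl : w l = u) :
    ∃ v : VIdx n w, vertexExp n w v = Finsupp.single i 1 + Finsupp.single j 1 + Finsupp.single l 1 := by
  rcases eq_one_or_eq_two_of_ne_zero u hu with rfl | rfl
  · exact ⟨Sum.inl (⟨i, hi⟩, ⟨j, hj⟩, ⟨l, hl⟩), rfl⟩
  · exact ⟨Sum.inr (Sum.inl (⟨i, hi⟩, ⟨j, hj⟩, ⟨l, hl⟩)), rfl⟩

/-- **A weight-`0` monomial divisible by a vertex generator lies in the vertex ideal** (the quotient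
is again a weight-`0` monomial). [OURS · L1 W4.5c] -/
theorem monomial_mem_vertexIdeal_of_le (e : Fin n →₀ ℕ) (he : Finsupp.weight w e = 0) (v : VIdx n w)
    (hle : vertexExp n w v ≤ e) :
    (⟨monomial e 1, monomial_mem_cone k n w he 1⟩ : cone k n w) ∈ vertexIdeal k n w := by
  have hsplit : vertexExp n w v + (e - vertexExp n w v) = e := add_tsub_cancel_of_le hle
  have hw' : Finsupp.weight w (e - vertexExp n w v) = 0 := by
    have h := congrArg (Finsupp.weight w) hsplit
    rwa [map_add, weight_vertexExp, zero_add, he] at h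
  have hfac : (⟨monomial e 1, monomial_mem_cone k n w he 1⟩ : cone k n w) =
      vertexGen k n w v * ⟨monomial (e - vertexExp n w v) 1, monomial_mem_cone k n w hw' 1⟩ :=
    Subtype.ext (by rw [Subalgebra.coe_mul, coe_vertexGen, monomial_mul, one_mul, hsplit])
  rw [hfac]
  exact Ideal.mul_mem_right _ _ (vertexGen_mem_vertexIdeal k n w v)

/-- Pointwise form of `single i 1 + single j 1 + single l 1 ≤ e`. [folklore] -/
theorem triple_le_iff (i j l : Fin n) (e : Fin n →₀ ℕ) :
    Finsupp.single i 1 + Finsupp.single j 1 + Finsupp.single l 1 ≤ e ↔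
      ∀ t, (if i = t then 1 else 0) + (if j = t then 1 else 0) + (if l = t then 1 else 0) ≤ e t := by
  simp only [Finsupp.le_def, Finsupp.add_apply, Finsupp.single_apply]

/-- **Generation**: every weight-`0` monomial touching a non-passenger variable lies in the vertex
ideal — it is divisible (with weight-`0` quotient) by some `x_iy_j`, `x_ix_jx_l` or `y_iy_jy_l`.
[OURS · L1 W4.5c] -/
theorem monomial_mem_vertexIdeal (e : Fin n →₀ ℕ) (he : Finsupp.weight w e = 0)
    (hs : ∃ s, w s ≠ 0 ∧ 1 ≤ e s) :
    (⟨monomial e 1, monomial_mem_cone k n w he 1⟩ : cone k n w) ∈ vertexIdeal k n w := by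
  classical
  obtain ⟨s₀, hs₀w, hs₀e⟩ := hs
  -- a mixed pair, if both weights occur
  by_cases hboth : (∃ i, w i = 1 ∧ 1 ≤ e i) ∧ (∃ z, w z = 2 ∧ 1 ≤ e z)
  · obtain ⟨⟨i, hi, hei⟩, ⟨z, hz, hez⟩⟩ := hboth
    have hiz : i ≠ z := fun h => by rw [h, hz] at hi; exact absurd hi (by decide)
    refine monomial_mem_vertexIdeal_of_le k n w e he (Sum.inr (Sum.inr (⟨i, hi⟩, ⟨z, hz⟩))) ?_
    show Finsupp.single i 1 + Finsupp.single z 1 ≤ e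
    intro t
    simp only [Finsupp.add_apply, Finsupp.single_apply]
    split_ifs with h1 h2 h2 <;> first | omega | (subst_vars; omega)
  -- otherwise only the weight `u := w s₀` occurs
  · let u := w s₀
    have hother : ∀ s, w s ≠ 0 → w s ≠ u → e s = 0 := by
      intro s hs hsu
      by_contra hes
      have hes' : 1 ≤ e s := Nat.one_le_iff_ne_zero.mpr hes
      apply hboth
      rcases eq_one_or_eq_two_of_ne_zero (w s₀) hs₀w with h0 | h0 <;>
        rcases eq_one_or_eq_two_of_ne_zero (w s) hs with h1 | h1
      · exact absurd (h1.trans h0.symm) hsu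
      · exact ⟨⟨s₀, h0, hs₀e⟩, ⟨s, h1, hes'⟩⟩
      · exact ⟨⟨s, h1, hes'⟩, ⟨s₀, h0, hs₀e⟩⟩
      · exact absurd (h1.trans h0.symm) hsu
    -- `T = ∑_{w s = u} e s` is divisible by `3`
    let T : ℕ := ∑ s, e s * (if w s = u then 1 else 0)
    have hT3 : 3 ∣ T := by
      have hw : Finsupp.weight w e = ((T : ℕ) : ZMod 3) * u := by
        rw [weight_eq_sum, Nat.cast_sum, Finset.sum_mul]
        refine Finset.sum_congr rfl fun s _ => ?_
        by_cases hsu : w s = u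
        · simp [hsu]
        · by_cases hs0 : w s = 0
          · simp [hs0, show (0 : ZMod 3) ≠ u from fun h => hs₀w h.symm]
          · simp [hsu, hother s hs0 hsu]
      rw [he] at hw
      rcases mul_eq_zero.mp hw.symm with h | h
      · exact (ZMod.natCast_eq_zero_iff _ _).mp h
      · exact absurd h hs₀w
    -- the single summands of `T`
    have hTs : ∀ s, e s * (if w s = u then 1 else 0) ≤ T := fun s =>
      Finset.single_le_sum (f := fun s => e s * (if w s = u then 1 else 0)) (fun _ _ => Nat.zero_le _)
        (Finset.mem_univ s)
    have hsum_erase : ∀ s, T = e s * (if w s = u then 1 else 0) +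
        ∑ t ∈ Finset.univ.erase s, e t * (if w t = u then 1 else 0) := fun s =>
      (Finset.add_sum_erase _ _ (Finset.mem_univ s)).symm
    have hu0 : w s₀ = u := rfl
    have hT1 : 1 ≤ T := le_trans (by simp [hu0]; exact hs₀e) (hTs s₀)
    -- extracting a triple
    have hconc : ∀ (i j l : Fin n), w i = u → w j = u → w l = u →
        Finsupp.single i 1 + Finsupp.single j 1 + Finsupp.single l 1 ≤ e →
        (⟨monomial e 1, monomial_mem_cone k n w he 1⟩ : cone k n w) ∈ vertexIdeal k n w := by
      intro i j l hi hj hl hle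
      obtain ⟨v, hv⟩ := exists_vertexExp_triple n w hs₀w i j l hi hj hl
      exact monomial_mem_vertexIdeal_of_le k n w e he v (hv ▸ hle)
    by_cases h3 : 3 ≤ e s₀
    · exact hconc s₀ s₀ s₀ hu0 hu0 hu0 ((triple_le_iff n s₀ s₀ s₀ e).mpr fun t => by
        split_ifs <;> first | omega | (subst_vars; omega))
    -- a second variable `j ≠ s₀` of weight `u` in the support
    have hrest : ∑ t ∈ Finset.univ.erase s₀, e t * (if w t = u then 1 else 0) ≠ 0 := by
      have := hsum_erase s₀; simp only [hu0, if_true, mul_one] at this; omega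
    obtain ⟨j, hjmem, hj⟩ := Finset.exists_ne_zero_of_sum_ne_zero hrest
    have hjs : j ≠ s₀ := Finset.ne_of_mem_erase hjmem
    have hju : w j = u := by by_contra h; simp [h] at hj
    have hej : 1 ≤ e j := by
      simp only [hju, if_true, mul_one] at hj; exact Nat.one_le_iff_ne_zero.mpr hj
    by_cases h2 : 2 ≤ e s₀
    · exact hconc s₀ s₀ j hu0 hu0 hju ((triple_le_iff n s₀ s₀ j e).mpr fun t => by
        split_ifs <;> first | omega | (subst_vars; omega))
    by_cases hj2 : 2 ≤ e j
    · exact hconc s₀ j j hu0 hju hju ((triple_le_iff n s₀ j j e).mpr fun t => by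
        split_ifs <;> first | omega | (subst_vars; omega))
    -- a third variable `l ∉ {s₀, j}` of weight `u` in the support
    have hrest2 : ∑ t ∈ (Finset.univ.erase s₀).erase j, e t * (if w t = u then 1 else 0) ≠ 0 := by
      have h1 := hsum_erase s₀
      have h2' := (Finset.add_sum_erase _ (fun t => e t * (if w t = u then 1 else 0))
        (Finset.mem_erase.mpr ⟨hjs, Finset.mem_univ j⟩)).symm
      simp only [hu0, hju, if_true, mul_one] at h1 h2'
      omega
    obtain ⟨l, hlmem, hl⟩ := Finset.exists_ne_zero_of_sum_ne_zero hrest2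
    have hlj : l ≠ j := Finset.ne_of_mem_erase hlmem
    have hls : l ≠ s₀ := Finset.ne_of_mem_erase (Finset.mem_of_mem_erase hlmem)
    have hlu : w l = u := by by_contra h; simp [h] at hl
    have hel : 1 ≤ e l := by
      simp only [hlu, if_true, mul_one] at hl; exact Nat.one_le_iff_ne_zero.mpr hl
    exact hconc s₀ j l hu0 hju hlu ((triple_le_iff n s₀ j l e).mpr fun t => by
      split_ifs <;> first | omega | (subst_vars; omega))

/-! ## The vertex ideal is the kernel of the passenger projection, hence prime -/

/-- The passenger projection kills every vertex generator and fixes passenger monomials: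
`π₀ (x^e) = x^e` if `e` is supported on passengers, `0` otherwise. [OURS · L1 W4.5c] -/
theorem passengerProj_monomial (e : Fin n →₀ ℕ) :
    MvPolynomial.aeval (R := k) (fun s => if w s = 0 then (X s : MvPolynomial (Fin n) k) else 0)
        (monomial e (1 : k)) =
      if ∀ s, e s ≠ 0 → w s = 0 then (monomial e (1 : k) : MvPolynomial (Fin n) k) else 0 := by
  classical
  rw [aeval_monomial, map_one, one_mul]
  split_ifs with hpass
  · rw [← prod_X_pow_eq_monomial, Finsupp.prod]
    refine Finset.prod_congr rfl fun s hs => ?_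
    rw [if_pos (hpass s (Finsupp.mem_support_iff.mp hs))]
  · push Not at hpass
    obtain ⟨s, hes, hws⟩ := hpass
    rw [Finsupp.prod]
    exact Finset.prod_eq_zero (Finsupp.mem_support_iff.mpr hes) (by rw [if_neg hws, zero_pow hes])

/-- **The vertex ideal is the kernel of the passenger projection** `cone → k[x]`,
`x_s ↦ x_s` (`w s = 0`), `x_s ↦ 0` (`w s ≠ 0`). [OURS · L1 W4.5c] -/
theorem vertexIdeal_eq_ker :
    vertexIdeal k n w = RingHom.ker
      (((MvPolynomial.aeval fun s => if w s = 0 then (X s : MvPolynomial (Fin n) k) else 0).toRingHom).comp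
        (cone k n w).val.toRingHom) := by
  set ρ := ((MvPolynomial.aeval fun s => if w s = 0 then (X s : MvPolynomial (Fin n) k) else 0).toRingHom).comp
    (cone k n w).val.toRingHom with hρ
  have hρapp : ∀ f : cone k n w, ρ f =
      MvPolynomial.aeval (fun s => if w s = 0 then (X s : MvPolynomial (Fin n) k) else 0)
        (f : MvPolynomial (Fin n) k) := fun f => rfl
  apply le_antisymm
  · -- the generators are killed
    refine Ideal.span_le.mpr ?_
    rintro _ ⟨i', rfl⟩
    have hc : ((vertexFamily k n w i' : cone k n w) : MvPolynomial (Fin n) k) =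
        monomial (vertexExp n w ((Fintype.equivFin (VIdx n w)).symm i')) 1 := rfl
    rw [SetLike.mem_coe, RingHom.mem_ker, hρapp, hc, passengerProj_monomial, if_neg]
    obtain ⟨s, hs, hes⟩ := exists_pos_vertexExp n w ((Fintype.equivFin (VIdx n w)).symm i')
    push Not
    exact ⟨s, by omega, hs⟩
  · -- an element of the kernel has no passenger-only monomial
    rintro ⟨f, hf⟩ hker
    rw [RingHom.mem_ker, hρapp] at hker
    have hnopass : ∀ e ∈ f.support, ∃ s, w s ≠ 0 ∧ 1 ≤ e s := by
      intro e he
      by_contra hcon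
      push Not at hcon
      have hpass : ∀ s, e s ≠ 0 → w s = 0 := fun s hs => by
        by_contra hws; exact absurd (hcon s hws) (by omega)
      -- the coefficient of `x^e` survives the projection
      have hcoeff : coeff e (MvPolynomial.aeval
          (fun s => if w s = 0 then (X s : MvPolynomial (Fin n) k) else 0) f) = coeff e f := by
        conv_lhs => rw [f.as_sum]
        rw [map_sum, coeff_sum]
        rw [Finset.sum_eq_single e]
        · rw [← mul_one (coeff e f), ← smul_eq_mul, ← smul_monomial, map_smul, passengerProj_monomial,
            if_pos hpass, coeff_smul, coeff_monomial, if_pos rfl, smul_eq_mul]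
        · intro e' he' hne
          rw [← mul_one (coeff e' f), ← smul_eq_mul, ← smul_monomial, map_smul, passengerProj_monomial,
            coeff_smul]
          split_ifs
          · rw [coeff_monomial, if_neg hne, smul_zero]
          · rw [coeff_zero, smul_zero]
        · intro hnot; exact absurd he hnot
      rw [hker, coeff_zero] at hcoeff
      exact (Finsupp.mem_support_iff.mp he) hcoeff.symm
    -- decompose into monomials
    let μ : (Fin n →₀ ℕ) → cone k n w := fun e =>
      if he : Finsupp.weight w e = 0 then ⟨monomial e 1, monomial_mem_cone k n w he 1⟩ else 0
    have hμ : ∀ (e) (he : e ∈ f.support), μ e = ⟨monomial e 1,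
        monomial_mem_cone k n w (hf (Finsupp.mem_support_iff.mp he)) 1⟩ := by
      intro e he
      have hwe : Finsupp.weight w e = 0 := hf (Finsupp.mem_support_iff.mp he)
      simp [μ, hwe]
    have hdec : (⟨f, hf⟩ : cone k n w) = ∑ e ∈ f.support, coeff e f • μ e := by
      apply Subtype.ext
      change f = ((∑ e ∈ f.support, coeff e f • μ e : cone k n w) : MvPolynomial (Fin n) k)
      rw [AddSubmonoidClass.coe_finsetSum]
      conv_lhs => rw [f.as_sum]
      refine Finset.sum_congr rfl fun e he => ?_
      rw [Subalgebra.coe_smul, hμ e he, smul_monomial, smul_eq_mul, mul_one]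
    rw [hdec]
    refine Ideal.sum_mem _ fun e he => ?_
    rw [Algebra.smul_def]
    refine Ideal.mul_mem_left _ _ ?_
    rw [hμ e he]
    exact monomial_mem_vertexIdeal k n w e (hf (Finsupp.mem_support_iff.mp he)) (hnopass e he)

/-- **The reduced vertex ideal of `⅓(w)` is prime** (the quotient is the passenger polynomial ring).
[OURS · L1 W4.5c] -/
theorem vertexIdeal_isPrime : (vertexIdeal k n w).IsPrime := by
  rw [vertexIdeal_eq_ker]
  exact RingHom.ker_isPrime _

/-- Hence the reduced vertex ideal is radical (the `hJ₀` input of the V4U-style cone bricks).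
[OURS · L1 W4.5c] -/
theorem vertexIdeal_isRadical : (vertexIdeal k n w).IsRadical :=
  (vertexIdeal_isPrime k n w).isRadical

end Summit.ResolutionOfSingularities.ResolutionOfSingularities.Theorems.WildQuotientResolution.ThirdCone

end
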